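import Summits.BirchSwinnertonDyer.BirchSwinnertonDyer.Theorems.ManinLocalTwoThreeNegOneTwistConductorAtTwo
import Summits.BirchSwinnertonDyer.BirchSwinnertonDyer.Theorems.ManinLocalTwoThreeConductorExponentFourAtTwo
import Literature.NumberTheory.DiophantineGeometry.TameAdditiveTypesAtTwoProofs
import HarnessLib

/-!
# «16 ∥ N descends», rows `I₂*/10 → III*/10` and `I₃*/11 → II*/11`: the `χ₋₄`-twist of a curve of type `I₂*` (`ord₂ Δ_min = 10`) resp.
# `I₃*` (`ord₂ Δ_min = 11`) at `2` has `f₂ = 3` (route `ManinLocalTwoThree`, crux C2 `ManinOddAtFour` stmt-BirchSwinnertonDyer-22967;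
# an g32 §11 S-an-63 / S-an-63L, stratum `(f, f^d) = (4, 3)`; cell bsd-f2-manin, p2 gen 14)

Barrios–Roy–Sahajpal–Tallana–Tobin–Wiersema 2025, Thm. 5.1, Table localdata-dodd, `d ≡ 3 (mod 4)`: `Iₙ>0*`, `n = 2, v(a₁) = 1 ↦ III*`,
`(δ, δ^d) = (10, 10)`, `(f, f^d) = (4, 3)`; `n = 3, v(a₁) = 1 ↦ II*`, `(11, 11)`, `(4, 3)` — kernel-checked for `d = −1` by Tate's algorithm
over `ℤ₂`, in the format of this seat's S-an-58 / S-an-60 files: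
* §1 (any ring / DVR with `2` a uniformiser): on a DEEP Step-7 form `N = [2α, 2β, 8γ, 8q, 16r]` (`8 ∣ a₃`),
  `Δ = 2¹⁰·(−(α² + 2β)²·B₈ + 2J)`, `B₈ = α²r − q² + 2(βr − αγq + βγ²)` (`b₈ = 64B₈`); hence `4 ∣ a₁ ⟹ 2¹² ∣ Δ`, and
  `α, B₈` units `⟹ ord Δ = 10`.  So `ord Δ ∈ {10, 11}` forces `α` odd, and `ord Δ = 11` forces `B₈` even — the `v(a₁) = 1` rows.
* §2 (`ℤ₂`): the twist `T = [0, −(α² + 2β), 0, 8(q + αγ), −16(γ² + r)]` under `(1; 0, α, 4(γ + r))` becomes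
  `[2α, −2(α² + β), 8(γ + r), 8(q − αr), −16(2γ² + 2γr + r² + r)]`, of step-9 shape (`2 ∣ a₁`, `4 ∣ a₂`, `8 ∣ a₃, a₄`, `32 ∣ a₆`: `α, β` odd,
  `r² + r` even); `ord Δ = 10` forbids `16 ∣ a₄` (that shape has `ord Δ ≥ 11`), so Step 9 returns `III*`; `ord Δ = 11` gives `B₈` even, i.e.
  `q − αr` even, `16 ∣ a₄`, and forbids `64 ∣ a₆` (the step-11 shape has `ord Δ ≥ 12`), so Step 10 returns `II*`.
* §3 the assembly at the place of `ℤ` above `2` (`conductorExponent_negTwist_of_exitModel`): `f₂(W ⊗ (−1)) = 10 + 1 − 8 = 11 + 1 − 9 = 3`.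
HONEST FRAMING: local bookkeeping in print, kernel-checked; nothing about BSD or Manin's conjecture is proved; C2 OPEN.
[cite: BarriosEtAl2025, Thm. 5.1 (arXiv:2501.03209 p. 16), Table localdata-dodd, rows I*ₙ, n = 2, 3, v(a₁) = 1, d ≡ 3 (mod 4)]
[cite: SilvermanATAEC1994, IV.9.4 Steps 7–10 (PDF pp. 345–346) and IV.11.1]
-/

set_option autoImplicit false
-- lint-debt: the directory name repeats the summit name (sibling precedent `ManinLocalTwoThreeNegOneTwistConductorAtTwo.lean`)
set_option linter.dupNamespace false

noncomputable section

open scoped Classical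
open Polynomial IsLocalRing WeierstrassCurve
open IsDiscreteValuationRing hiding maximalIdeal
open Literature.NumberTheory.DiophantineGeometry Literature.NumberTheory.DiophantineGeometry.TateAlgorithm
  Literature.NumberTheory.DiophantineGeometry.TateAlgorithm.CharTwo Literature.NumberTheory.EllipticCurves

namespace Summit.BirchSwinnertonDyer.BirchSwinnertonDyer.Theorems.ManinLocalTwoThree

/-! ## §1 The deep Step-7 form `[2α, 2β, 8γ, 8q, 16r]`: `Δ = 2¹⁰(−(α²+2β)²B₈ + 2J)` -/

section Identity

variable {R : Type*} [CommRing R]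

/-- **`Δ` of the deep Step-7 form** `[2α, 2β, 8γ, 8q, 16r]`: `Δ = 2¹⁰·(−(α² + 2β)²B₈ + 2J)` with `B₈ = α²r − q² + 2(βr − αγq + βγ²)`
(`b₂ = 4(α² + 2β)`, `b₄ = 16(q + αγ)`, `b₆ = 64(γ² + r)`, `b₈ = 64B₈`). [cite: SilvermanATAEC1994, IV.9.4 Step 7 and III.1] -/
theorem Δ_of_istarDeepForm (N : WeierstrassCurve R) {α β γ q r : R} (h₁ : N.a₁ = 2 * α) (h₂ : N.a₂ = 2 * β)
    (h₃ : N.a₃ = 8 * γ) (h₄ : N.a₄ = 8 * q) (h₆ : N.a₆ = 16 * r) :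
    N.Δ = 2 ^ 10 * (-((α ^ 2 + 2 * β) ^ 2 * (α ^ 2 * r - q ^ 2 + 2 * (β * r - α * γ * q + β * γ ^ 2))) +
      2 * (-16 * (q + α * γ) ^ 3 - 54 * (γ ^ 2 + r) ^ 2 + 18 * (α ^ 2 + 2 * β) * (q + α * γ) * (γ ^ 2 + r))) := by
  simp only [WeierstrassCurve.Δ, WeierstrassCurve.b₂, WeierstrassCurve.b₄, WeierstrassCurve.b₆, WeierstrassCurve.b₈, h₁, h₂, h₃, h₄, h₆]
  ring

/-- **`4 ∣ a₁` on the deep Step-7 form gives `2¹² ∣ Δ`** (`(α² + 2β)² = 4(2α′² + β)²`, `2J ∈ 4R`). [cite: SilvermanATAEC1994, IV.9.4 Step 7] -/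
theorem two_pow_twelve_dvd_Δ_of_istarDeepForm_of_four_dvd (N : WeierstrassCurve R) {α' β γ q r : R} (h₁ : N.a₁ = 2 * (2 * α'))
    (h₂ : N.a₂ = 2 * β) (h₃ : N.a₃ = 8 * γ) (h₄ : N.a₄ = 8 * q) (h₆ : N.a₆ = 16 * r) : (2 : R) ^ 12 ∣ N.Δ := by
  rw [Δ_of_istarDeepForm N h₁ h₂ h₃ h₄ h₆]
  exact ⟨-((2 * α' ^ 2 + β) ^ 2 * ((2 * α') ^ 2 * r - q ^ 2 + 2 * (β * r - 2 * α' * γ * q + β * γ ^ 2)))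
      - 8 * (q + 2 * α' * γ) ^ 3 - 27 * (γ ^ 2 + r) ^ 2 + 18 * (2 * α' ^ 2 + β) * (q + 2 * α' * γ) * (γ ^ 2 + r), by ring⟩

end Identity

section DVR

variable {R : Type*} [CommRing R] [IsDomain R] [IsDiscreteValuationRing R]

/-- **`ord Δ = 10` on the deep Step-7 form when `α` and `B₈` are units** (`2` a uniformiser). [cite: SilvermanATAEC1994, IV.9.4 Step 7] -/
theorem addVal_Δ_toNat_of_istarDeepForm_of_isUnit (h2 : Irreducible (2 : R)) (N : WeierstrassCurve R) {α β γ q r : R}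
    (h₁ : N.a₁ = 2 * α) (h₂ : N.a₂ = 2 * β) (h₃ : N.a₃ = 8 * γ) (h₄ : N.a₄ = 8 * q) (h₆ : N.a₆ = 16 * r) (hα : IsUnit α)
    (hB : IsUnit (α ^ 2 * r - q ^ 2 + 2 * (β * r - α * γ * q + β * γ ^ 2))) : (addVal R N.Δ).toNat = 10 := by
  have hA : IsUnit (α ^ 2 + 2 * β) := isUnit_add_mul_of_isUnit h2 (hα.pow 2) β
  refine addVal_toNat_eq_of_eq_add h2 (c := 1) (n := 10)
    (u := -((α ^ 2 + 2 * β) ^ 2 * (α ^ 2 * r - q ^ 2 + 2 * (β * r - α * γ * q + β * γ ^ 2))))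
    (y := -16 * (q + α * γ) ^ 3 - 54 * (γ ^ 2 + r) ^ 2 + 18 * (α ^ 2 + 2 * β) * (q + α * γ) * (γ ^ 2 + r))
    isUnit_one ((hA.pow 2).mul hB).neg ?_
  rw [one_mul, Δ_of_istarDeepForm N h₁ h₂ h₃ h₄ h₆]

end DVR

/-! ## §2 The twist over `ℤ₂` and its Step-9 exits -/

/-- In `ℤ₂`, `r² + r` is even. [folklore] -/
theorem exists_sq_add_self_eq_two_mul_padicInt (r : ℤ_[2]) : ∃ ν : ℤ_[2], r ^ 2 + r = 2 * ν := by
  by_cases hr : IsUnit r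
  · obtain ⟨κ, hκ⟩ := exists_eq_one_add_two_mul_of_isUnit_padicInt hr
    exact ⟨1 + 3 * κ + 2 * κ ^ 2, by rw [hκ]; ring⟩
  · obtain ⟨w, hw⟩ := padicInt_two_eq_two_mul_of_not_isUnit hr
    exact ⟨2 * w ^ 2 + w, by rw [hw]; ring⟩

/-- Twist of the deep Step-7 form `[2α, 2β, 8γ, 8q, 16r]`: `[0, −(α² + 2β), 0, 8(q + αγ), −16(γ² + r)]`. [cite: SilvermanAEC2009, X.2 Prop. 2.4] -/
theorem quadraticTwist_negOne_map_of_istarDeepForm (N : WeierstrassCurve ℤ_[2]) {α β γ q r : ℤ_[2]}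
    (h₁ : N.a₁ = 2 * α) (h₂ : N.a₂ = 2 * β) (h₃ : N.a₃ = 8 * γ) (h₄ : N.a₄ = 8 * q) (h₆ : N.a₆ = 16 * r) :
    (N.map (algebraMap ℤ_[2] ℚ_[2])).quadraticTwist (-1) =
      (⟨0, -(α ^ 2 + 2 * β), 0, 8 * (q + α * γ), -(16 * (γ ^ 2 + r))⟩ : WeierstrassCurve ℤ_[2]).map (algebraMap ℤ_[2] ℚ_[2]) := by
  obtain ⟨a₁, a₂, a₃, a₄, a₆⟩ := N
  simp only at h₁ h₂ h₃ h₄ h₆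
  subst h₁ h₂ h₃ h₄ h₆
  have c2 : ((2 : ℤ_[2]) : ℚ_[2]) = 2 := map_ofNat PadicInt.Coe.ringHom 2
  have c8 : ((8 : ℤ_[2]) : ℚ_[2]) = 8 := map_ofNat PadicInt.Coe.ringHom 8
  have c16 : ((16 : ℤ_[2]) : ℚ_[2]) = 16 := map_ofNat PadicInt.Coe.ringHom 16
  ext <;> simp [WeierstrassCurve.quadraticTwist, WeierstrassCurve.map, WeierstrassCurve.b₂, WeierstrassCurve.b₄,
    WeierstrassCurve.b₆, c2, c8, c16] <;> ring

/-- The common renormalisation `(1; 0, α, 4(γ + r))` of the twisted deep form, RAW coefficients: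
`[2α, −2(α² + β), 8(γ + r), 8(q − αr), −16(2γ² + 2γr + (r² + r))]`. [cite: SilvermanATAEC1994, IV.9.4 Step 9] -/
theorem istarDeepTwist_coeff (α β γ q r : ℤ_[2]) :
    let T' := (⟨1, 0, α, 4 * (γ + r)⟩ : VariableChange ℤ_[2]) •
      (⟨0, -(α ^ 2 + 2 * β), 0, 8 * (q + α * γ), -(16 * (γ ^ 2 + r))⟩ : WeierstrassCurve ℤ_[2])
    T'.a₁ = 2 * α ∧ T'.a₂ = -(2 * (α ^ 2 + β)) ∧ T'.a₃ = 8 * (γ + r) ∧ T'.a₄ = 8 * (q - α * r) ∧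
      T'.a₆ = -(16 * (2 * γ ^ 2 + 2 * γ * r + (r ^ 2 + r))) := by
  intro T'
  refine ⟨?_, ?_, ?_, ?_, ?_⟩
  · show T'.a₁ = _
    simp only [T', variableChange_a₁]; simp
  · show T'.a₂ = _
    simp only [T', variableChange_a₂]; simp; ring
  · show T'.a₃ = _
    simp only [T', variableChange_a₃]; simp; ring
  · show T'.a₄ = _
    simp only [T', variableChange_a₄]; simp; ring
  · show T'.a₆ = _
    simp only [T', variableChange_a₆]; simp; ring

/-- The common renormalisation `(1; 0, α, 4(γ + r))` of the twisted deep form: for `α, β` odd its coefficients have the step-9 shape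
`2 ∣ a₁`, `4 ∣ a₂`, `8 ∣ a₃, a₄`, `32 ∣ a₆` (`α² + β`, `r² + r` even), here in terms of the tree's uniformiser `ϖ` (`2 = ϖε`).
[cite: SilvermanATAEC1994, IV.9.4 Step 9] -/
theorem istarDeepTwist_shape {ε : ℤ_[2]} (hpε : (2 : ℤ_[2]) = uniformizer ℤ_[2] * ε) (α β γ q r : ℤ_[2]) (hα : IsUnit α)
    (hβ : IsUnit β) :
    let T' := (⟨1, 0, α, 4 * (γ + r)⟩ : VariableChange ℤ_[2]) •
      (⟨0, -(α ^ 2 + 2 * β), 0, 8 * (q + α * γ), -(16 * (γ ^ 2 + r))⟩ : WeierstrassCurve ℤ_[2])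
    (T'.a₁ = uniformizer ℤ_[2] * (ε * α)) ∧ (∃ μ, T'.a₂ = uniformizer ℤ_[2] ^ 2 * μ) ∧
      T'.a₃ = uniformizer ℤ_[2] ^ 3 * (ε ^ 3 * (γ + r)) ∧ T'.a₄ = uniformizer ℤ_[2] ^ 3 * (ε ^ 3 * (q - α * r)) ∧
      (∃ w, T'.a₆ = uniformizer ℤ_[2] ^ 5 * w) := by
  intro T'
  obtain ⟨r1, r2, r3, r4, r6⟩ := istarDeepTwist_coeff α β γ q r
  obtain ⟨κ, hκ⟩ := exists_eq_one_add_two_mul_of_isUnit_padicInt hα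
  obtain ⟨lam, hlam⟩ := exists_eq_one_add_two_mul_of_isUnit_padicInt hβ
  obtain ⟨ν, hν⟩ := exists_sq_add_self_eq_two_mul_padicInt r
  set ϖ : ℤ_[2] := uniformizer ℤ_[2] with hϖ
  have f4 : (4 : ℤ_[2]) = ϖ ^ 2 * ε ^ 2 := by rw [show (4 : ℤ_[2]) = 2 ^ 2 by norm_num, hpε]; ring
  have f8 : (8 : ℤ_[2]) = ϖ ^ 3 * ε ^ 3 := by rw [show (8 : ℤ_[2]) = 2 ^ 3 by norm_num, hpε]; ring
  have f32 : (32 : ℤ_[2]) = ϖ ^ 5 * ε ^ 5 := by rw [show (32 : ℤ_[2]) = 2 ^ 5 by norm_num, hpε]; ring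
  have hαβ : α ^ 2 + β = 2 * (1 + 2 * κ + 2 * κ ^ 2 + lam) := by rw [hκ, hlam]; ring
  refine ⟨?_, ⟨-(ε ^ 2 * (1 + 2 * κ + 2 * κ ^ 2 + lam)), ?_⟩, ?_, ?_, ⟨-(ε ^ 5 * (γ ^ 2 + γ * r + ν)), ?_⟩⟩
  · rw [r1]; linear_combination α * hpε
  · rw [r2, hαβ, show (2 : ℤ_[2]) * (2 * (1 + 2 * κ + 2 * κ ^ 2 + lam)) = 4 * (1 + 2 * κ + 2 * κ ^ 2 + lam) by ring, f4]
    ring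
  · rw [r3, f8]; ring
  · rw [r4, f8]; ring
  · have : T'.a₆ = -(32 * (γ ^ 2 + γ * r + ν)) := by rw [r6, hν]; ring
    rw [this, f32]; ring

/-- **Exit at III* (row `I₂*/10`).**  For units `α, β` and any `γ, q, r ∈ ℤ₂`, if the renormalised twist
`T′ = (1; 0, α, 4(γ + r)) • [0, −(α² + 2β), 0, 8(q + αγ), −16(γ² + r)]` has `2¹¹ ∤ Δ(T′)` (it has `ord Δ = 10` in row `I₂*/10`), Tate's
algorithm returns `III*` on it: the step-9 shape holds, and `16 ∣ a₄` would give `2¹¹ ∣ Δ`. [cite: SilvermanATAEC1994, IV.9.4 Steps 1–9] -/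
theorem kodairaSymbolOfMinimal_negTwist_toIIIstar (α β γ q r : ℤ_[2]) (hα : IsUnit α) (hβ : IsUnit β)
    (hΔ : ¬ (2 : ℤ_[2]) ^ 11 ∣ ((⟨1, 0, α, 4 * (γ + r)⟩ : VariableChange ℤ_[2]) •
      (⟨0, -(α ^ 2 + 2 * β), 0, 8 * (q + α * γ), -(16 * (γ ^ 2 + r))⟩ : WeierstrassCurve ℤ_[2])).Δ) :
    ((⟨1, 0, α, 4 * (γ + r)⟩ : VariableChange ℤ_[2]) •
      (⟨0, -(α ^ 2 + 2 * β), 0, 8 * (q + α * γ), -(16 * (γ ^ 2 + r))⟩ : WeierstrassCurve ℤ_[2])).kodairaSymbolOfMinimal = .IIIstar := by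
  obtain ⟨ε, hε, hpε⟩ := Literature.NumberTheory.EllipticCurves.TwistGoodTwo.exists_isUnit_two_eq_uniformizer_mul_padicInt
  haveI : Fact (Nat.Prime 2) := ⟨Nat.prime_two⟩
  haveI : Finite (ResidueField ℤ_[2]) := Finite.of_equiv _ (PadicInt.residueField (p := 2)).toEquiv.symm
  have hirr : Irreducible (2 : ℤ_[2]) := by exact_mod_cast PadicInt.irreducible_p (p := 2)
  have h2m : (2 : ℤ_[2]) ∈ maximalIdeal ℤ_[2] := (IsLocalRing.mem_maximalIdeal _).mpr hirr.not_isUnit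
  set ϖ : ℤ_[2] := uniformizer ℤ_[2] with hϖ
  set T' := (⟨1, 0, α, 4 * (γ + r)⟩ : VariableChange ℤ_[2]) •
      (⟨0, -(α ^ 2 + 2 * β), 0, 8 * (q + α * γ), -(16 * (γ ^ 2 + r))⟩ : WeierstrassCurve ℤ_[2]) with hT'
  obtain ⟨e1, ⟨μ, e2⟩, e3, e4, ⟨w, e6⟩⟩ := istarDeepTwist_shape hpε α β γ q r hα hβ
  have g1 : ϖ ∣ T'.a₁ := ⟨_, e1⟩
  have g2 : ϖ ^ 2 ∣ T'.a₂ := ⟨_, e2⟩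
  have g3 : ϖ ^ 3 ∣ T'.a₃ := ⟨_, e3⟩
  have g4 : ϖ ^ 3 ∣ T'.a₄ := ⟨_, e4⟩
  have g6 : ϖ ^ 5 ∣ T'.a₆ := ⟨_, e6⟩
  refine kodairaSymbolOfMinimal_eq_IIIstar_of_step9 g1 g2 g3 g4 g6 ?_
  intro h9
  apply hΔ
  -- the shape `(1, 2, 3, 4, 5)` has `Δ ∈ 𝔪¹¹`
  have hm : ∀ {x : ℤ_[2]} {k : ℕ}, ϖ ^ k ∣ x → x ∈ maximalIdeal ℤ_[2] ^ k := fun {x k} h ↦ mem_maximalIdeal_pow_iff_dvd.mpr h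
  have h11 : T'.Δ ∈ maximalIdeal ℤ_[2] ^ 11 :=
    Δ_mem_pow_of_a_of_two_mem T' h2m 2 4 6 7 (n₁ := 1) (n₂ := 2) (n₃ := 3) (n₄ := 4) (n₆ := 5)
      (by rw [pow_one]; exact mem_maximalIdeal_iff_dvd.mpr g1) (hm g2) (hm g3) (hm h9) (hm g6)
  exact (mem_maximalIdeal_pow_iff_dvd_of_irreducible hirr _ _).mp h11

/-- **Exit at II* (row `I₃*/11`).**  For units `α, β`, any `γ, q, r ∈ ℤ₂` with `q − αr` even, if the renormalised twist `T′` (as in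
`kodairaSymbolOfMinimal_negTwist_toIIIstar`) has `2¹² ∤ Δ(T′)` (it has `ord Δ = 11` in row `I₃*/11`), Tate's algorithm returns `II*`: now `16 ∣ a₄`,
and `64 ∣ a₆` would be the step-11 shape, with `2¹² ∣ Δ`. [cite: SilvermanATAEC1994, IV.9.4 Steps 1–10] -/
theorem kodairaSymbolOfMinimal_negTwist_toIIstar (α β γ q r : ℤ_[2]) (hα : IsUnit α) (hβ : IsUnit β) (hqr : (2 : ℤ_[2]) ∣ q - α * r)
    (hΔ : ¬ (2 : ℤ_[2]) ^ 12 ∣ ((⟨1, 0, α, 4 * (γ + r)⟩ : VariableChange ℤ_[2]) •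
      (⟨0, -(α ^ 2 + 2 * β), 0, 8 * (q + α * γ), -(16 * (γ ^ 2 + r))⟩ : WeierstrassCurve ℤ_[2])).Δ) :
    ((⟨1, 0, α, 4 * (γ + r)⟩ : VariableChange ℤ_[2]) •
      (⟨0, -(α ^ 2 + 2 * β), 0, 8 * (q + α * γ), -(16 * (γ ^ 2 + r))⟩ : WeierstrassCurve ℤ_[2])).kodairaSymbolOfMinimal = .IIstar := by
  obtain ⟨ε, hε, hpε⟩ := Literature.NumberTheory.EllipticCurves.TwistGoodTwo.exists_isUnit_two_eq_uniformizer_mul_padicInt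
  haveI : Fact (Nat.Prime 2) := ⟨Nat.prime_two⟩
  haveI : Finite (ResidueField ℤ_[2]) := Finite.of_equiv _ (PadicInt.residueField (p := 2)).toEquiv.symm
  have hirr : Irreducible (2 : ℤ_[2]) := by exact_mod_cast PadicInt.irreducible_p (p := 2)
  have h2m : (2 : ℤ_[2]) ∈ maximalIdeal ℤ_[2] := (IsLocalRing.mem_maximalIdeal _).mpr hirr.not_isUnit
  set ϖ : ℤ_[2] := uniformizer ℤ_[2] with hϖ
  set T' := (⟨1, 0, α, 4 * (γ + r)⟩ : VariableChange ℤ_[2]) •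
      (⟨0, -(α ^ 2 + 2 * β), 0, 8 * (q + α * γ), -(16 * (γ ^ 2 + r))⟩ : WeierstrassCurve ℤ_[2]) with hT'
  obtain ⟨e1, ⟨μ, e2⟩, e3, e4, ⟨w, e6⟩⟩ := istarDeepTwist_shape hpε α β γ q r hα hβ
  obtain ⟨ζ, hζ⟩ := hqr
  have g1 : ϖ ∣ T'.a₁ := ⟨_, e1⟩
  have g2 : ϖ ^ 2 ∣ T'.a₂ := ⟨_, e2⟩
  have g3 : ϖ ^ 3 ∣ T'.a₃ := ⟨_, e3⟩
  have g4' : ϖ ^ 4 ∣ T'.a₄ := ⟨ε ^ 4 * ζ, by rw [e4, hζ, pow_succ ϖ 3]; linear_combination (ϖ ^ 3 * ε ^ 3 * ζ) * hpε⟩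
  have g6 : ϖ ^ 5 ∣ T'.a₆ := ⟨_, e6⟩
  refine kodairaSymbolOfMinimal_eq_IIstar_of_step9 g1 g2 g3 g4' g6 ?_
  intro h10
  apply hΔ
  -- the step-11 shape `(1, 2, 3, 4, 6)` has `Δ ∈ 𝔪¹²`
  have hm : ∀ {x : ℤ_[2]} {k : ℕ}, ϖ ^ k ∣ x → x ∈ maximalIdeal ℤ_[2] ^ k := fun {x k} h ↦ mem_maximalIdeal_pow_iff_dvd.mpr h
  have h12 : T'.Δ ∈ maximalIdeal ℤ_[2] ^ 12 :=
    Δ_mem_pow_of_a_of_two_mem T' h2m 2 4 6 8 (n₁ := 1) (n₂ := 2) (n₃ := 3) (n₄ := 4) (n₆ := 6)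
      (by rw [pow_one]; exact mem_maximalIdeal_iff_dvd.mpr g1) (hm g2) (hm g3) (hm g4') (hm h10)
  exact (mem_maximalIdeal_pow_iff_dvd_of_irreducible hirr _ _).mp h12

/-! ## §3 The assembly at the place of `ℤ` above `2`: rows `I₂*/10`, `I₃*/11` have `f₂(W ⊗ (−1)) = 3` -/

/-- **Rows `I₂*/10 → III*/10` and `I₃*/11 → II*/11` of «16 ∥ N descends» (Barrios et al. 2025 Thm. 5.1, `Iₙ>0*`, `n ∈ {2, 3}`, `v(a₁) = 1`,
`d ≡ 3 (mod 4)`; kernel-checked for `d = −1`)**: an elliptic curve `W/ℚ` of Kodaira type `I₂*` with `ord₂ Δ_min = 10`, or `I₃*` with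
`ord₂ Δ_min = 11`, at `2` (two of the seven `f₂ = 4` rows) has `f₂(W ⊗ (−1)) = 3` (types `III*` resp. `II*`, same `ord₂ Δ_min`).
[cite: BarriosEtAl2025, Thm. 5.1 (arXiv:2501.03209 p. 16), Table localdata-dodd, rows I*ₙ, n = 2, 3, v(a₁) = 1] [cite: SilvermanATAEC1994, IV.9.4 and IV.11.1] -/
theorem conductorExponent_quadraticTwist_negOne_eq_three_of_Istar_two_or_three (W : WeierstrassCurve ℚ) [W.IsElliptic]
    (hK : (W.kodairaSymbolAt ((Rat.HeightOneSpectrum.primesEquiv (R := ℤ)).symm ⟨2, Nat.prime_two⟩) = .Istar 2 ∧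
        W.ordMinimalDiscriminant ((Rat.HeightOneSpectrum.primesEquiv (R := ℤ)).symm ⟨2, Nat.prime_two⟩) = 10) ∨
      (W.kodairaSymbolAt ((Rat.HeightOneSpectrum.primesEquiv (R := ℤ)).symm ⟨2, Nat.prime_two⟩) = .Istar 3 ∧
        W.ordMinimalDiscriminant ((Rat.HeightOneSpectrum.primesEquiv (R := ℤ)).symm ⟨2, Nat.prime_two⟩) = 11)) :
    (W.quadraticTwist ((-1 : ℤ) : ℚ)).conductorExponent
        ((Rat.HeightOneSpectrum.primesEquiv (R := ℤ)).symm ⟨2, Nat.prime_two⟩) = 3 := by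
  haveI : Fact (Nat.Prime 2) := ⟨Nat.prime_two⟩
  haveI : Finite (ResidueField ℤ_[2]) := Finite.of_equiv _ (PadicInt.residueField (p := 2)).toEquiv.symm
  have hirr : Irreducible (2 : ℤ_[2]) := by exact_mod_cast PadicInt.irreducible_p (p := 2)
  have hm : ∀ {x : ℤ_[2]}, x ∈ maximalIdeal ℤ_[2] ↔ (2 : ℤ_[2]) ∣ x := fun {x} ↦ mem_maximalIdeal_iff_dvd_of_irreducible hirr x
  have hmn : ∀ {x : ℤ_[2]} {n : ℕ}, x ∈ maximalIdeal ℤ_[2] ^ n ↔ (2 : ℤ_[2]) ^ n ∣ x := fun {x n} ↦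
    mem_maximalIdeal_pow_iff_dvd_of_irreducible hirr x n
  set v : IsDedekindDomain.HeightOneSpectrum ℤ := (Rat.HeightOneSpectrum.primesEquiv (R := ℤ)).symm ⟨2, Nat.prime_two⟩
    with hvdef
  have e : Rat.HeightOneSpectrum.primesEquiv (R := ℤ) v = ⟨2, Nat.prime_two⟩ := Equiv.apply_symm_apply _ _
  -- the type and `ord Δ_min`, read over `ℤ₂`
  have hKp := WeierstrassCurve.kodairaSymbolAt_eq_padic (R := ℤ) v W
  rw [e] at hKp
  change W.kodairaSymbolAt v = (((W.baseChange ℚ_[2]).minimal ℤ_[2]).integralModel ℤ_[2]).kodairaSymbolOfMinimal at hKp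
  have hOp := WeierstrassCurve.ordMinimalDiscriminant_eq_padic (R := ℤ) v W
  rw [e] at hOp
  change W.ordMinimalDiscriminant v =
    (IsDiscreteValuationRing.addVal ℤ_[2] (((W.baseChange ℚ_[2]).minimal ℤ_[2]).integralModel ℤ_[2]).Δ).toNat at hOp
  set X : WeierstrassCurve ℚ_[2] := W.baseChange ℚ_[2] with hX
  set V₀ : WeierstrassCurve ℤ_[2] := (X.minimal ℤ_[2]).integralModel ℤ_[2] with hV₀
  set E : VariableChange ℚ_[2] := (X.exists_isMinimal ℤ_[2]).choose with hE
  have hmin : X.minimal ℤ_[2] = E • X := rfl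
  have hV₀X : V₀.baseChange ℚ_[2] = X.minimal ℤ_[2] := WeierstrassCurve.baseChange_integralModel_eq ℤ_[2] _
  have hV₀Δ : V₀.Δ ≠ 0 := by
    intro h0
    have h1 : (V₀.baseChange ℚ_[2]).Δ = 0 := by
      rw [WeierstrassCurve.baseChange, WeierstrassCurve.map_Δ, h0, map_zero]
    rw [hV₀X, hmin] at h1
    exact (E • X).isUnit_Δ.ne_zero h1
  have hordD : ∀ D : VariableChange ℤ_[2], (addVal ℤ_[2] (D • V₀).Δ).toNat = W.ordMinimalDiscriminant v := fun D ↦ by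
    rw [addVal_Δ_smul_toNat, ← hOp]
  have hΔD : ∀ D : VariableChange ℤ_[2], (D • V₀).Δ ≠ 0 := fun D ↦ by
    rw [variableChange_Δ]; exact mul_ne_zero (pow_ne_zero 12 (Units.ne_zero _)) hV₀Δ
  -- the twist over `ℚ₂`
  have hd0 : ((-1 : ℤ) : ℚ) ≠ 0 := by norm_num
  haveI := W.isElliptic_quadraticTwist hd0
  set Xm : WeierstrassCurve ℚ_[2] := (W.quadraticTwist ((-1 : ℤ) : ℚ)).baseChange ℚ_[2] with hXm
  have hXmX : Xm = X.quadraticTwist (-1) := by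
    rw [hXm, hX, WeierstrassCurve.baseChange, WeierstrassCurve.baseChange, WeierstrassCurve.map_quadraticTwist]
    simp
  have twistΔ : ∀ (D : VariableChange ℤ_[2]) (T : WeierstrassCurve ℤ_[2]),
      ((D • V₀).map (algebraMap ℤ_[2] ℚ_[2])).quadraticTwist (-1) = T.map (algebraMap ℤ_[2] ℚ_[2]) → T.Δ = (D • V₀).Δ := by
    intro D T hNT
    have h1 : (T.map (algebraMap ℤ_[2] ℚ_[2])).Δ = (((D • V₀).map (algebraMap ℤ_[2] ℚ_[2])).quadraticTwist (-1)).Δ := by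
      rw [hNT]
    rw [WeierstrassCurve.map_Δ, WeierstrassCurve.quadraticTwist_Δ, WeierstrassCurve.map_Δ] at h1
    norm_num at h1
    exact IsFractionRing.injective ℤ_[2] ℚ_[2] h1
  have key : ∀ (D : VariableChange ℤ_[2]) (T : WeierstrassCurve ℤ_[2]) (C₆ : VariableChange ℤ_[2]),
      ((D • V₀).map (algebraMap ℤ_[2] ℚ_[2])).quadraticTwist (-1) = T.map (algebraMap ℤ_[2] ℚ_[2]) →
      (C₆ • T).kodairaSymbolOfMinimal ≠ .I 0 →
      (W.quadraticTwist ((-1 : ℤ) : ℚ)).conductorExponent v =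
        W.ordMinimalDiscriminant v + 1 - (C₆ • T).kodairaSymbolOfMinimal.numComponents := by
    intro D T C₆ hNT hne
    set Ctot : VariableChange ℚ_[2] := D.map (algebraMap ℤ_[2] ℚ_[2]) * E with hCtot
    have hCX : Ctot • X = (D • V₀).map (algebraMap ℤ_[2] ℚ_[2]) := by
      rw [hCtot, mul_smul, ← hmin, ← hV₀X]
      exact WeierstrassCurve.map_variableChange _ _ _
    set C₁ : VariableChange ℚ_[2] := ⟨Ctot.u, (-1) * Ctot.r, 0, 0⟩ with hC₁
    have hT : T.map (algebraMap ℤ_[2] ℚ_[2]) = C₁ • Xm := by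
      rw [← hNT, ← hCX, WeierstrassCurve.quadraticTwist_smul, hXmX]
    have hT' : (C₆ • T).map (algebraMap ℤ_[2] ℚ_[2]) = (C₆.map (algebraMap ℤ_[2] ℚ_[2]) * C₁) • Xm := by
      rw [mul_smul, ← hT]
      exact (WeierstrassCurve.map_variableChange _ _ _).symm
    rw [conductorExponent_negTwist_of_exitModel W (C₆ • T) _ hT' hne, addVal_Δ_smul_toNat, twistΔ D T hNT, hordD D]
  -- the common data of the two rows: type `Istar (n + 2)`, `ord Δ = n + 10`, `n ∈ {0, 1}`
  obtain ⟨n, hn1, hT, hord⟩ : ∃ n : ℕ, n ≤ 1 ∧ W.kodairaSymbolAt v = .Istar (n + 2) ∧ W.ordMinimalDiscriminant v = n + 10 := by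
    rcases hK with ⟨h1, h2⟩ | ⟨h1, h2⟩
    · exact ⟨0, by omega, h1, h2⟩
    · exact ⟨1, le_rfl, h1, h2⟩
  rw [hT] at hKp
  -- the Step-7 form and the units forced by `ord Δ`
  obtain ⟨D, h1m, h2m', h2n, h3m, h4m, h6m⟩ := exists_smul_of_kodairaSymbolOfMinimal_eq_Istar_succ V₀ hKp.symm
  obtain ⟨α, hα⟩ := hm.mp h1m
  obtain ⟨β, hβ⟩ := hm.mp h2m'
  obtain ⟨γ₀, hγ₀⟩ := hmn.mp h3m
  obtain ⟨q, hq'⟩ := hmn.mp h4m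
  obtain ⟨r, hr'⟩ := hmn.mp h6m
  have hβu : IsUnit β := by
    rw [isUnit_iff_not_dvd hirr]
    rintro ⟨β', hβ'⟩
    exact h2n (hmn.mpr ⟨β', by rw [hβ, hβ', pow_two, mul_assoc]⟩)
  have hn : (addVal ℤ_[2] (D • V₀).Δ).toNat = n + 10 := by rw [hordD D, hord]
  -- `8 ∣ a₃`: otherwise `ord Δ = 8`
  have hγ₀nu : ¬ IsUnit γ₀ := fun hγu ↦ by
    have h8 := addVal_Δ_toNat_of_istarSuccForm_of_isUnit hirr (D • V₀) hα hβ (by rw [hγ₀]; ring) (by rw [hq']; ring)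
      (by rw [hr']; ring) hγu
    omega
  obtain ⟨γ, hγ⟩ := padicInt_two_eq_two_mul_of_not_isUnit hγ₀nu
  have h3 : (D • V₀).a₃ = 8 * γ := by rw [hγ₀, hγ]; ring
  have h4 : (D • V₀).a₄ = 8 * q := by rw [hq']; ring
  have h6 : (D • V₀).a₆ = 16 * r := by rw [hr']; ring
  -- `α` is a unit: otherwise `2¹² ∣ Δ`
  have hαu : IsUnit α := by
    by_contra hαu
    obtain ⟨α', hα'⟩ := padicInt_two_eq_two_mul_of_not_isUnit hαu
    have h12 := two_pow_twelve_dvd_Δ_of_istarDeepForm_of_four_dvd (D • V₀) (α' := α') (by rw [hα, hα']) hβ h3 h4 h6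
    have := le_addVal_toNat_of_pow_dvd hirr (hΔD D) h12
    omega
  -- the twist model and its renormalisation
  have hNT := quadraticTwist_negOne_map_of_istarDeepForm (D • V₀) hα hβ h3 h4 h6
  set T : WeierstrassCurve ℤ_[2] := ⟨0, -(α ^ 2 + 2 * β), 0, 8 * (q + α * γ), -(16 * (γ ^ 2 + r))⟩ with hTdef
  set C : VariableChange ℤ_[2] := ⟨1, 0, α, 4 * (γ + r)⟩ with hCdef
  have hTΔ := twistΔ D T hNT
  have hCTΔ : (C • T).Δ = (D • V₀).Δ := by rw [Δ_smul_of_u_eq_one rfl, hTΔ]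
  have hndvd : ∀ k : ℕ, n + 11 ≤ k → ¬ (2 : ℤ_[2]) ^ k ∣ (C • T).Δ := fun k hk hdvd ↦ by
    have := le_addVal_toNat_of_pow_dvd hirr (by rw [hCTΔ]; exact hΔD D) hdvd
    rw [hCTΔ, hn] at this
    omega
  rcases Nat.le_one_iff_eq_zero_or_eq_one.mp hn1 with rfl | rfl
  · -- row `I₂*/10`: exit at `III*`
    have hexit : (C • T).kodairaSymbolOfMinimal = .IIIstar :=
      kodairaSymbolOfMinimal_negTwist_toIIIstar α β γ q r hαu hβu (hndvd 11 (by omega))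
    rw [key D T C hNT (by rw [hexit]; decide), hexit, hord]
    rfl
  · -- row `I₃*/11`: `B₈` is even (else `ord Δ = 10`), so `q − αr` is even; exit at `II*`
    obtain ⟨κ, hκ⟩ := exists_eq_one_add_two_mul_of_isUnit_padicInt hαu
    obtain ⟨ν, hν⟩ := exists_sq_add_self_eq_two_mul_padicInt q
    have hqr : (2 : ℤ_[2]) ∣ q - α * r := by
      by_contra hnd
      have hu : IsUnit (q - α * r) := (isUnit_iff_not_dvd hirr _).mpr hnd
      have hB : IsUnit (α ^ 2 * r - q ^ 2 + 2 * (β * r - α * γ * q + β * γ ^ 2)) := by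
        have e8 : α ^ 2 * r - q ^ 2 + 2 * (β * r - α * γ * q + β * γ ^ 2) =
            -(q - α * r) + 2 * (α * r * κ - (ν - q) + (β * r - α * γ * q + β * γ ^ 2)) := by
          linear_combination (α * r) * hκ - hν
        rw [e8]
        exact isUnit_add_mul_of_isUnit hirr hu.neg _
      have h10 := addVal_Δ_toNat_of_istarDeepForm_of_isUnit hirr (D • V₀) hα hβ h3 h4 h6 hαu hB
      omega
    have hexit : (C • T).kodairaSymbolOfMinimal = .IIstar :=
      kodairaSymbolOfMinimal_negTwist_toIIstar α β γ q r hαu hβu hqr (hndvd 12 (by omega))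
    rw [key D T C hNT (by rw [hexit]; decide), hexit, hord]
    rfl

/-- **Rows `I₂*/10`, `I₃*/11` at any place `v` of `ℤ` above `2`.** [cite: BarriosEtAl2025, Thm. 5.1, rows I*₂, I*₃ with v(a₁) = 1] -/
theorem conductorExponent_quadraticTwist_negOne_eq_three_of_Istar_two_or_three' (W : WeierstrassCurve ℚ) [W.IsElliptic]
    (v : IsDedekindDomain.HeightOneSpectrum ℤ) (hv : Rat.HeightOneSpectrum.natGenerator v = 2)
    (hK : (W.kodairaSymbolAt v = .Istar 2 ∧ W.ordMinimalDiscriminant v = 10) ∨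
      (W.kodairaSymbolAt v = .Istar 3 ∧ W.ordMinimalDiscriminant v = 11)) :
    (W.quadraticTwist ((-1 : ℤ) : ℚ)).conductorExponent v = 3 := by
  have hpv : Rat.HeightOneSpectrum.primesEquiv (R := ℤ) v = ⟨2, Nat.prime_two⟩ := Subtype.ext hv
  have hvv : v = (Rat.HeightOneSpectrum.primesEquiv (R := ℤ)).symm ⟨2, Nat.prime_two⟩ := by
    rw [← hpv, Equiv.symm_apply_apply]
  subst hvv
  exact conductorExponent_quadraticTwist_negOne_eq_three_of_Istar_two_or_three W hK

end Summit.BirchSwinnertonDyer.BirchSwinnertonDyer.Theorems.ManinLocalTwoThree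

end
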